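import Literature.NumberTheory.Automorphic.LieAlgebraGLStabilizer
import Literature.NumberTheory.Automorphic.NilpotentExpRootHom
import HarnessLib

/-!
# Determinant and trace on a stable subspace; `Lie {det|_W = 1} ⊆ {tr|_W = 0}`
(trunk T-AUTOMORPHIC, G25 AutomorphicL; tool for the graph proof of `chevalley_isomorphism(_abstract)`,
Springer 9.6.2: the one-dimensional characters `g ↦ det (g|_W)` of a linear group on its stable subspaces)

For a subspace `W ≤ kⁿ` we fix a basis matrix `bMat W` (columns a basis of `W`) and a left inverse
`lMat W` (`lMat_mul_bMat`), and define the **coordinate matrix `restrMat W M = lMat · M · bMat`** of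
a matrix `M`; when `M` stabilises `W` this is the matrix of `M|_W` (`mul_bMat_eq`:
`M · bMat = bMat · restrMat W M`), multiplicative (`restrMat_mul`, `restrMat_pow`,
`restrMat_exp`), so that:

* `det (restrMat W (exp N)) = 1` for nilpotent `N` stabilising `W` (`det_restrMat_exp`) — unipotent
  elements have determinant `1` on stable subspaces;
* the polynomial `detPoly W` in the coordinates of `GL n` with `detPoly W (g) = det (restrMat W g)`
  (`eval_detPoly`) has differential `tr (restrMat W X)` at `1` (`tangentDeriv_detPoly`, from
  `det (1 + ε C) = 1 + ε tr C`);
* for a subgroup `𝒢` stabilising `W`, the subgroup `detOneSubgroup W 𝒢 = {g ∈ 𝒢 | det (g|_W) = 1}`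
  and **`trace_restrMat_eq_zero_of_mem_lieAlgebraGL`**: `X ∈ Lie(detOneSubgroup) ⇒ tr (X|_W) = 0`
  (the differential of the character `det (·|_W)`, Springer 4.4.13);
* `trace_restrMat_of_forall_eq_smul`: if `M` acts on `W` by the scalar `c` then
  `tr (restrMat W M) = dim W · c`.

Everything is proved; [folklore] (Springer 2.4, 4.4.13 for differentials of characters).

## Mathlib

`Module.finBasis`, `LinearMap.exists_leftInverse_of_injective`, `LinearMap.toMatrix'`,
`Matrix.det_one_add_smul` (through `det_dualMatrix` of `LieAlgebraGLStabilizer.lean`),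
`IsNilpotent.exp`. Nothing here duplicates a Mathlib or Literature declaration (searched
`restrMat`, `detPoly`, `detOneSubgroup`, `LinearMap.det` + `restrict` in Literature).

## References

* [SpringerLAG1998] T. A. Springer, *Linear Algebraic Groups*, 2nd ed. (1998), 2.4.2, 4.4.13.
-/

noncomputable section

open scoped MatrixGroups
open TrivSqZeroExt DualNumber

namespace Literature.NumberTheory.Automorphic

variable {k : Type*} [Field k] {n : Type*} [Fintype n] [DecidableEq n]

namespace StableDet

omit [Fintype n] [DecidableEq n] in
/-- `(M · e_j)_i = M i j`. [folklore] -/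
lemma mulVec_single_one_apply {m : Type*} [Fintype m] [DecidableEq m] (M : Matrix n m k) (j : m) (i : n) :
    M.mulVec (Pi.single j 1) i = M i j := by
  simp [Matrix.mulVec, dotProduct, Pi.single_apply]

variable (W : Submodule k (n → k))

/-- The dimension of `W`. [folklore] -/
abbrev dimW : ℕ := Module.finrank k W

/-- **The basis matrix of `W`**: its columns are the vectors of `Module.finBasis k W`. [folklore] -/
def bMat : Matrix n (Fin (dimW W)) k :=
  Matrix.of fun i j => ((Module.finBasis k W j : ↥W) : n → k) i

omit [DecidableEq n] in
/-- `bMat · c = ∑ c_j b_j`. [folklore] -/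
lemma bMat_mulVec (c : Fin (dimW W) → k) :
    (bMat W).mulVec c = ∑ j, c j • ((Module.finBasis k W j : ↥W) : n → k) := by
  ext i
  simp [bMat, Matrix.mulVec, dotProduct, Finset.sum_apply, mul_comm]

omit [DecidableEq n] in
/-- `bMat · c` is the vector of `W` with coordinates `c`. [folklore] -/
lemma bMat_mulVec_eq_repr_symm (c : Fin (dimW W) → k) :
    (bMat W).mulVec c = (((Module.finBasis k W).repr.symm (Finsupp.equivFunOnFinite.symm c) : ↥W) : n → k) := by
  rw [bMat_mulVec, Module.Basis.repr_symm_apply, Finsupp.linearCombination_apply,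
    Finsupp.sum_fintype _ _ (by simp)]
  simp

omit [DecidableEq n] in
/-- The columns of `bMat` span `W`: `bMat · c ∈ W`. [folklore] -/
lemma bMat_mulVec_mem (c : Fin (dimW W) → k) : (bMat W).mulVec c ∈ W := by
  rw [bMat_mulVec_eq_repr_symm]; exact Submodule.coe_mem _

omit [DecidableEq n] in
/-- Every `w ∈ W` is `bMat · c` for a unique coordinate vector. [folklore] -/
lemma exists_bMat_mulVec_eq {w : n → k} (hw : w ∈ W) : ∃ c, (bMat W).mulVec c = w := by
  refine ⟨Finsupp.equivFunOnFinite ((Module.finBasis k W).repr ⟨w, hw⟩), ?_⟩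
  rw [bMat_mulVec_eq_repr_symm]
  simp

omit [DecidableEq n] in
/-- `c ↦ bMat · c` is injective (the columns are linearly independent). [folklore] -/
lemma bMat_mulVec_injective : Function.Injective (bMat W).mulVec := by
  intro c c' h
  rw [bMat_mulVec_eq_repr_symm, bMat_mulVec_eq_repr_symm] at h
  have h' := (Module.finBasis k W).repr.symm.injective (Subtype.ext h)
  exact Finsupp.equivFunOnFinite.symm.injective h'

/-- **A left inverse `lMat` of the basis matrix.** [folklore] -/
def lMat : Matrix (Fin (dimW W)) n k :=
  LinearMap.toMatrix' (LinearMap.exists_leftInverse_of_injective (Matrix.toLin' (bMat W))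
    (by rw [LinearMap.ker_eq_bot]; exact bMat_mulVec_injective W)).choose

/-- `lMat · bMat = 1`. [folklore] -/
theorem lMat_mul_bMat : lMat W * bMat W = 1 := by
  have h := (LinearMap.exists_leftInverse_of_injective (Matrix.toLin' (bMat W))
    (by rw [LinearMap.ker_eq_bot]; exact bMat_mulVec_injective W)).choose_spec
  apply (Matrix.toLin' (R := k)).injective
  rw [Matrix.toLin'_mul, lMat, Matrix.toLin'_toMatrix', h, Matrix.toLin'_one]

/-- **The coordinate matrix of `M` on `W`**: `lMat · M · bMat`. [folklore] -/
def restrMat (M : Matrix n n k) : Matrix (Fin (dimW W)) (Fin (dimW W)) k := lMat W * M * bMat W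

/-- `restrMat` is additive. [folklore] -/
lemma restrMat_add (M N : Matrix n n k) : restrMat W (M + N) = restrMat W M + restrMat W N := by
  simp [restrMat, Matrix.mul_add, Matrix.add_mul]

/-- `restrMat` is homogeneous. [folklore] -/
lemma restrMat_smul (c : k) (M : Matrix n n k) : restrMat W (c • M) = c • restrMat W M := by
  simp [restrMat]

/-- `restrMat` of a sum. [folklore] -/
lemma restrMat_sum {ι : Type*} (s : Finset ι) (M : ι → Matrix n n k) :
    restrMat W (∑ i ∈ s, M i) = ∑ i ∈ s, restrMat W (M i) := by
  simp [restrMat, Matrix.mul_sum, Matrix.sum_mul]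

/-- `restrMat W 1 = 1`. [folklore] -/
lemma restrMat_one : restrMat W 1 = 1 := by rw [restrMat, Matrix.mul_one, lMat_mul_bMat]

/-- `restrMat W 0 = 0`. [folklore] -/
lemma restrMat_zero : restrMat W 0 = 0 := by simp [restrMat]

/-- The stability predicate `M W ⊆ W`. [folklore] -/
def Stab (M : Matrix n n k) : Prop := ∀ w ∈ W, M.mulVec w ∈ W

/-- **`M · bMat = bMat · restrMat W M` when `M` stabilises `W`.** [folklore] -/
theorem mul_bMat_eq {M : Matrix n n k} (hM : Stab W M) : M * bMat W = bMat W * restrMat W M := by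
  -- columnwise: `M b_j ∈ W` has coordinates `C_j`
  have hcol : ∀ j, ∃ c : Fin (dimW W) → k, (bMat W).mulVec c = (M * bMat W).mulVec (Pi.single j 1) := by
    intro j
    apply exists_bMat_mulVec_eq
    rw [← Matrix.mulVec_mulVec]
    exact hM _ (bMat_mulVec_mem W _)
  choose C hC using hcol
  -- the matrix with columns `C j`
  have hMB : M * bMat W = bMat W * Matrix.of (fun i j => C j i) := by
    ext i j
    have h := congrFun (hC j) i
    rw [mulVec_single_one_apply] at h
    rw [← h]
    simp [Matrix.mul_apply, Matrix.mulVec, dotProduct, Matrix.of_apply]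
  calc M * bMat W = bMat W * Matrix.of (fun i j => C j i) := hMB
    _ = bMat W * (lMat W * (bMat W * Matrix.of (fun i j => C j i))) := by
        rw [← Matrix.mul_assoc (lMat W), lMat_mul_bMat, Matrix.one_mul]
    _ = bMat W * restrMat W M := by rw [restrMat, Matrix.mul_assoc (lMat W), hMB]

/-- **Multiplicativity on the stabiliser**: `restrMat W (M N) = restrMat W M · restrMat W N` when `N`
stabilises `W`. [folklore] -/
theorem restrMat_mul {M N : Matrix n n k} (hN : Stab W N) :
    restrMat W (M * N) = restrMat W M * restrMat W N := by
  conv_lhs => rw [restrMat, Matrix.mul_assoc, Matrix.mul_assoc, mul_bMat_eq W hN, ← Matrix.mul_assoc,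
    ← Matrix.mul_assoc]
  rfl

omit [DecidableEq n] in
/-- Stability is preserved by products. [folklore] -/
lemma Stab.mul {M N : Matrix n n k} (hM : Stab W M) (hN : Stab W N) : Stab W (M * N) :=
  fun w hw => by rw [← Matrix.mulVec_mulVec]; exact hM _ (hN w hw)

/-- Stability is preserved by powers. [folklore] -/
lemma Stab.pow {M : Matrix n n k} (hM : Stab W M) (m : ℕ) : Stab W (M ^ m) := by
  induction m with
  | zero => intro w hw; simpa using hw
  | succ m ih => rw [pow_succ]; exact ih.mul W hM

/-- `restrMat` of powers. [folklore] -/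
theorem restrMat_pow {M : Matrix n n k} (hM : Stab W M) (m : ℕ) : restrMat W (M ^ m) = restrMat W M ^ m := by
  induction m with
  | zero => rw [pow_zero, pow_zero, restrMat_one]
  | succ m ih => rw [pow_succ, restrMat_mul W hM, ih, pow_succ]

/-- `restrMat` of the exponential of a nilpotent stabilising matrix (characteristic `0`). [folklore] -/
theorem restrMat_exp [CharZero k] {N : Matrix n n k} (hN : IsNilpotent N) (hNW : Stab W N) :
    restrMat W (IsNilpotent.exp N) = IsNilpotent.exp (restrMat W N) := by
  obtain ⟨m, hm⟩ := hN
  have hm' : restrMat W N ^ m = 0 := by rw [← restrMat_pow W hNW, hm, restrMat_zero]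
  rw [IsNilpotent.exp_eq_sum hm, IsNilpotent.exp_eq_sum hm', restrMat_sum]
  refine Finset.sum_congr rfl fun i _ => ?_
  rw [← restrMat_pow W hNW]
  -- `ℚ`-scalars act through `k`
  rw [← algebraMap_smul k ((i.factorial : ℚ)⁻¹) (N ^ i), restrMat_smul, algebraMap_smul]

/-- **`det (exp N |_W) = 1`** for nilpotent `N` stabilising `W`: unipotent elements have determinant
`1` on stable subspaces. [cite: SpringerLAG1998, 2.4.2] -/
theorem det_restrMat_exp [CharZero k] {N : Matrix n n k} (hN : IsNilpotent N) (hNW : Stab W N) :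
    (restrMat W (IsNilpotent.exp N)).det = 1 := by
  rw [restrMat_exp W hN hNW]
  have hN' : IsNilpotent (restrMat W N) := by
    obtain ⟨m, hm⟩ := hN
    exact ⟨m, by rw [← restrMat_pow W hNW, hm, restrMat_zero]⟩
  have h := det_exp_smul hN' 1
  rwa [one_smul] at h

/-- **`tr (M|_W) = dim W · c` when `M` acts on `W` by the scalar `c`.** [folklore] -/
theorem trace_restrMat_of_forall_eq_smul {M : Matrix n n k} {c : k} (hM : ∀ w ∈ W, M.mulVec w = c • w) :
    (restrMat W M).trace = (dimW W : k) * c := by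
  have hMB : M * bMat W = c • bMat W := by
    ext i j
    have h := congrFun (hM _ (bMat_mulVec_mem W (Pi.single j 1))) i
    rw [Matrix.mulVec_mulVec, mulVec_single_one_apply, Pi.smul_apply, mulVec_single_one_apply] at h
    rw [Matrix.smul_apply, h]
  rw [restrMat, Matrix.mul_assoc, hMB, Matrix.mul_smul, lMat_mul_bMat, Matrix.trace_smul,
    Matrix.trace_one, Fintype.card_fin, smul_eq_mul, mul_comm]

/-! ### The determinant on `W` as a polynomial and its differential -/

/-- **The polynomial `det (lMat · x · bMat)`** in the coordinates of `GL n`. [folklore] -/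
def detPoly : MvPolynomial (GLCoord n) k :=
  ((lMat W).map MvPolynomial.C * genericMatrixGL n k * (bMat W).map MvPolynomial.C).det

/-- `detPoly W (g) = det (restrMat W g)`. [folklore] -/
theorem eval_detPoly (g : GL n k) :
    MvPolynomial.eval (glCoordFun g) (detPoly W) = (restrMat W (g : Matrix n n k)).det := by
  rw [detPoly, RingHom.map_det, RingHom.mapMatrix_apply, Matrix.map_mul, Matrix.map_mul,
    ← RingHom.mapMatrix_apply (MvPolynomial.eval (glCoordFun g)) (genericMatrixGL n k),
    eval_mapMatrix_genericMatrixGL]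
  congr 1
  rw [restrMat]
  congr 1
  · congr 1
    ext i j; simp
  · ext i j; simp

/-- **The differential of `det (·|_W)` at `1` is `tr (·|_W)`.** [cite: SpringerLAG1998, 4.4.13] -/
theorem tangentDeriv_detPoly (X : Matrix n n k) :
    tangentDeriv (detPoly W) X = (restrMat W X).trace := by
  rw [tangentDeriv, detPoly]
  have h : (MvPolynomial.aeval (dualPoint X) : MvPolynomial (GLCoord n) k →ₐ[k] k[ε])
      (((lMat W).map MvPolynomial.C * genericMatrixGL n k * (bMat W).map MvPolynomial.C).det) =
      ((lMat W).map (algebraMap k k[ε]) * dualMatrix X * (bMat W).map (algebraMap k k[ε])).det := by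
    rw [← AlgHom.coe_toRingHom, RingHom.map_det, RingHom.mapMatrix_apply, Matrix.map_mul, Matrix.map_mul,
      ← RingHom.mapMatrix_apply _ (genericMatrixGL n k), aeval_dualPoint_mapMatrix_genericMatrixGL]
    congr 2
    · congr 1
      rw [Matrix.map_map]; congr 1; funext a; simp
    · rw [Matrix.map_map]; congr 1; funext a; simp
  rw [h]
  -- `lMat (1 + ε X) bMat = 1 + ε restrMat W X`
  have h2 : (lMat W).map (algebraMap k k[ε]) * dualMatrix X * (bMat W).map (algebraMap k k[ε]) =
      dualMatrix (restrMat W X) := by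
    rw [dualMatrix, dualMatrix, Matrix.mul_add, Matrix.add_mul, Matrix.mul_one]
    congr 1
    · rw [← Matrix.map_mul, lMat_mul_bMat, Matrix.map_one (algebraMap k k[ε]) (map_zero _) (map_one _)]
    · rw [restrMat, map_inr_eq_eps_smul, map_inr_eq_eps_smul, Matrix.mul_smul, Matrix.smul_mul,
        ← Matrix.map_mul, ← Matrix.map_mul]
  rw [h2, det_dualMatrix]
  simp

/-! ### The subgroup `{g ∈ 𝒢 | det (g|_W) = 1}` and its Lie algebra -/

variable (𝒢 : Subgroup (GL n k))

/-- **`{g ∈ 𝒢 | det (g|_W) = 1}`** for a subgroup `𝒢` stabilising `W`. [folklore] -/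
def detOneSubgroup (h𝒢 : ∀ g ∈ 𝒢, Stab W (g : Matrix n n k)) : Subgroup (GL n k) where
  carrier := {g | g ∈ 𝒢 ∧ (restrMat W (g : Matrix n n k)).det = 1}
  one_mem' := ⟨𝒢.one_mem, by rw [Units.val_one, restrMat_one, Matrix.det_one]⟩
  mul_mem' := fun {a b} ha hb => ⟨𝒢.mul_mem ha.1 hb.1, by
    rw [Units.val_mul, restrMat_mul W (h𝒢 b hb.1), Matrix.det_mul, ha.2, hb.2, mul_one]⟩
  inv_mem' := fun {a} ha => ⟨𝒢.inv_mem ha.1, by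
    have h := congrArg Matrix.det (restrMat_mul W (M := ((a⁻¹ : GL n k) : Matrix n n k)) (h𝒢 a ha.1))
    rw [← Units.val_mul, inv_mul_cancel, Units.val_one, restrMat_one, Matrix.det_one, Matrix.det_mul,
      ha.2, mul_one] at h
    exact h.symm⟩

variable {W 𝒢}

/-- Membership in `detOneSubgroup`. [folklore] -/
lemma mem_detOneSubgroup_iff {h𝒢 : ∀ g ∈ 𝒢, Stab W (g : Matrix n n k)} {g : GL n k} :
    g ∈ detOneSubgroup W 𝒢 h𝒢 ↔ g ∈ 𝒢 ∧ (restrMat W (g : Matrix n n k)).det = 1 := Iff.rfl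

/-- `detOneSubgroup ≤ 𝒢`. [folklore] -/
lemma detOneSubgroup_le {h𝒢 : ∀ g ∈ 𝒢, Stab W (g : Matrix n n k)} : detOneSubgroup W 𝒢 h𝒢 ≤ 𝒢 :=
  fun _ hg => hg.1

/-- **`X ∈ Lie {g ∈ 𝒢 | det (g|_W) = 1} ⇒ tr (X|_W) = 0`** (the differential of the character
`det (·|_W)` vanishes on the Lie algebra of its kernel). [cite: SpringerLAG1998, 4.4.13] -/
theorem trace_restrMat_eq_zero_of_mem_lieAlgebraGL {h𝒢 : ∀ g ∈ 𝒢, Stab W (g : Matrix n n k)}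
    {X : Matrix n n k} (hX : X ∈ lieAlgebraGL (detOneSubgroup W 𝒢 h𝒢)) : (restrMat W X).trace = 0 := by
  have hp : detPoly W - 1 ∈ MvPolynomial.vanishingIdeal k
      (glCoordFun '' ((detOneSubgroup W 𝒢 h𝒢 : Subgroup (GL n k)) : Set (GL n k))) := by
    rw [MvPolynomial.mem_vanishingIdeal_iff]
    rintro _ ⟨g, hg, rfl⟩
    change MvPolynomial.eval (glCoordFun g) (detPoly W - 1) = 0
    rw [map_sub, map_one, eval_detPoly, (mem_detOneSubgroup_iff.1 hg).2, sub_self]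
  have h := (mem_lieAlgebraGL_iff.1 hX) _ hp
  rwa [tangentDeriv_sub, tangentDeriv_detPoly, ← MvPolynomial.C_1, tangentDeriv_C, sub_zero] at h

end StableDet

end Literature.NumberTheory.Automorphic
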